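import Summits.BirchSwinnertonDyer.BirchSwinnertonDyer.Theorems.GenusKolyvaginAtTwoMinimalTwinBSDTwoOddManinPinning
import Summits.BirchSwinnertonDyer.BirchSwinnertonDyer.Theorems.ManinLocalTwoThreeManinOddAtFourCdtThm1
import HarnessLib

/-!
# Route `GenusKolyvaginAtTwo`, crux U₂ `MinimalTwinBSDTwo` (stmt-BirchSwinnertonDyer-22985), LINE 23 «twin_swap» — THE STUB MANIN|₄ CLOSED AS TYPED:
# `OddCutManinResidueAtTwo` follows BY NAME from the closed crux `ManinLocalTwoThree.ManinOddAtFour` (stmt-BirchSwinnertonDyer-22967, closed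
# `proved` 2026-08-31T16:49Z by `ManinLocalTwoThree.ManinOddAtFour_proof`) through the g37 odd-isogeny transport — modulo the four printed-fact
# binders of 22967 (Mazur 1978 Cor. 4.1, Abbes–Ullmo 1996 Thm. A, Česnavičius 2018 Thm. 1.2, modularity `exists_isNewformOf`) and
# `nonempty_modularParametrizationData`

Seat `bsd-line-gk2-p2` g37 (PROVER seat 2/3, cell `bsd-f1-sign2`, LINE 23 holder), `--supports stmt-BirchSwinnertonDyer-22985 --as helper`.
THEOREMS ONLY (no definition, no named fact, no `sorry`).  BSD is NOT proved by any of this; U₂ is NOT proved; nothing of route GenusKolyvaginAtTwo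
is closed by this file.

STATUS OF RECORD OF THE INPUT (director-bsd (849)(4), (853)(1); the closing file `Theorems/ManinLocalTwoThreeManinOddAtFourCdtThm1.lean`, cell
bsd-f2-manin / bsd-wall): `ManinOddAtFour_proof` is PROVED AS TYPED (kernel, std axioms), **UDC-DEPENDENT** (it rests on the in-tree
unbounded-denominators term `calegariDimitrovTang2025_unboundedDenominators_holds`, CDT 2025 Thm. 1.0.1 as vendored, and Stevens 1982 Thm. 1.3.1 (b)
discharged in the tree), lean4checker replay and external expert read PENDING (audit (P†)); it is NOT an announcement of Manin's conjecture.  Every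
theorem below inherits exactly that status: MANIN|₄ is CLOSED AS TYPED, (P†)-pending, conditional on the displayed printed facts — not «proved in
print».  The g37 pin (`OddManin.exists_datum_odd_c_iff_odd_optimal_c`, p828855) says this is also the ONLY way MANIN|₄ can close: it is Manin mod 2
for the strong Weil curves.

* §1 `exists_datum_odd_c_conductor_of_four_dvd` — per curve: `W/ℚ` globally minimal, `E[2]` irreducible, `4 ∣ N_W` ⟹ a datum at level `N_W` with odd
  Manin constant (mod the five displayed facts; via 22967's closure + Edixhoven's optimal datum + the odd-isogeny transport).
* §2 ★★★ `oddCutManinResidue_of_printedFacts` — the text of the registered stub `TwinSwapV213.stub_oddCutManinResidue : OddCutManinResidueAtTwo`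
  VERBATIM, modulo the five displayed facts.  With it, EVERY stub of LINE 23 v2.13.1 is now a route item by name (WALL ×4, Q2), a conjunction of
  named facts (PRINT×8 — to which a v2.14 would add Mazur 1978 and `exists_isNewformOf` and then DELETE MANIN|₄: 7 → 6 stubs), or one of the three
  research leaves NVFROB · WITNESS_{dc,≥2} · KEX|off.
* §3 the same in U₂'s own hypotheses (`r_an = 1`, `#Sel₂ = 2` ⟹ `E[2]` irreducible, + GZK).

References: [CalegariDimitrovTang2025] Thm. 1.0.1; [Stevens1982] §1.3 Thm. 1.3.1 (b); [EdixhovenManin1991] Prop. 2; [GreenbergVatsal2000] §3 Rem. 3.4;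
[Mazur1978] Cor. 4.1; [AbbesUllmo1996] Thm. A; [Cesnavicius2018] Thm. 1.2; [BCDTJAMS2001] Thm. A.
-/

set_option autoImplicit false
set_option linter.dupNamespace false -- `Summit.<P>.<Sub>` repeats `BirchSwinnertonDyer` (D-0017)

noncomputable section

open scoped Classical MatrixGroups ModularForm NumberField

namespace Summit.BirchSwinnertonDyer.BirchSwinnertonDyer.Theorems.GenusExact.TwinSwap.OddManin

open Literature.NumberTheory.EllipticCurves WeierstrassCurve CongruenceSubgroup
  Literature.NumberTheory.EllipticCurves.ModularForms

/-! ## §1 Per curve: an odd Manin datum at `4 ∣ N_W`, from 22967's closure -/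

/-- **Odd Manin datum at additive `2` (`4 ∣ N_W`), CLOSED AS TYPED.**  For `W/ℚ` globally minimal with `E[2]` irreducible and `4 ∣ N_W`, granted the
four printed-fact binders of `ManinLocalTwoThree.ManinOddAtFour` (Mazur 1978 Cor. 4.1, Abbes–Ullmo 1996 Thm. A, Česnavičius 2018 Thm. 1.2 — lattice
renderings — and modularity `exists_isNewformOf`) and the modularity fact `nonempty_modularParametrizationData`: `W` has a datum at level `N_W` with
ODD Manin constant.  Proof: Edixhoven's optimal datum `(W₀, D₀)` of the class at level `N_W` (tree theorem) has odd `c₀` by the CLOSED crux 22967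
(`ManinLocalTwoThree.ManinOddAtFour_proof` — PROVED AS TYPED, UDC-dependent, audit (P†) pending), and the odd-isogeny transport
`exists_datum_odd_c_of_isIsogenous_odd_c` (p828855) moves it to `W`.  CONDITIONAL on the displayed facts; inherits 22967's status; BSD is NOT proved.
[cite: CalegariDimitrovTang2025, Thm. 1.0.1] [cite: Stevens1982, §1.3 Thm. 1.3.1 (b)] [cite: EdixhovenManin1991, Prop. 2]
[cite: GreenbergVatsal2000, §3, Remark 3.4] -/
theorem exists_datum_odd_c_conductor_of_four_dvd
    (hMaz : mazur_not_dvd_maninConstant_of_odd) (hAU : abbesUllmo_not_dvd_maninConstant_of_not_dvd_level)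
    (hCes : cesnavicius_not_two_dvd_maninConstant_of_two_dvd_level) (hnf : exists_isNewformOf) (hmodD : nonempty_modularParametrizationData)
    (W : WeierstrassCurve ℚ) [W.IsElliptic] [W.IsGloballyMinimal] [NeZero (W.conductorNorm ℤ)] (hirr : W.HasIrreducibleModPGaloisRep 2)
    (h4 : 4 ∣ W.conductorNorm ℤ) :
    ∃ Dt : ModularParametrizationData W (W.conductorNorm ℤ), Odd Dt.c := by
  obtain ⟨D⟩ := hmodD W
  obtain ⟨W₀, hW₀, hW₀', D₀, -, hiso, hopt, -⟩ := D.exists_optimalDatum_of_edixhoven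
    (fun hf' hL' q hq hq' ↦ edixhoven_int_of_neronLattice_eq_smul_periodLattice_holds hf' hL' q hq hq')
  have h2 : ¬ (2 : ℤ) ∣ D₀.maninConstant :=
    ManinLocalTwoThree.ManinOddAtFour_proof hMaz hAU hCes hnf W₀ D₀ hopt (by norm_num; exact h4)
  have hodd : Odd D₀.c := by
    rcases Int.even_or_odd D₀.c with h | h
    · exact absurd (even_iff_two_dvd.mp h) h2
    · exact h
  obtain ⟨Dk, -, -, -, hk⟩ := exists_datum_odd_c_of_isIsogenous_odd_c W hirr D W₀ D₀ hiso hodd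
  exact ⟨Dk, hk⟩

/-! ## §2 The stub MANIN|₄ of LINE 23, closed as typed -/

/-- **★★★ MANIN|₄ CLOSED AS TYPED.**  Granted the four printed-fact binders of crux 22967 (Mazur 1978 Cor. 4.1, Abbes–Ullmo 1996 Thm. A, Česnavičius
2018 Thm. 1.2, modularity `exists_isNewformOf`) and `nonempty_modularParametrizationData`, the text of the registered stub
`TwinSwapV213.stub_oddCutManinResidue : OddCutManinResidueAtTwo` of LINE 23 v2.13.1 holds VERBATIM: for every `W` on the odd habitat cut with `¬CM`,
`r_an = 1`, `#Sel₂ = 2` and `4 ∣ N_W`, some datum of `W` at level `N_W` has odd Manin constant.  Only the image hypothesis (`ρ_{W,2^n}` onto, at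
`n = 1`) and `4 ∣ N_W` are used.  Source of the oddness: the CLOSED crux `ManinLocalTwoThree.ManinOddAtFour` (stmt-BirchSwinnertonDyer-22967,
`ManinOddAtFour_proof`: PROVED AS TYPED, UDC-dependent via `calegariDimitrovTang2025_unboundedDenominators_holds`, audit (P†) pending — director-bsd
(849)(4)/(853)(1) wording), transported to `W` by p828855.  This theorem inherits that status; it is NOT a claim that Manin's conjecture or BSD is
proved.  For the pen: a v2.14 may add Mazur 1978 and `exists_isNewformOf` to PRINT and delete MANIN|₄ (7 → 6 stubs), citing this declaration.
[cite: CalegariDimitrovTang2025, Thm. 1.0.1] [cite: Stevens1982, §1.3 Thm. 1.3.1 (b)] [cite: EdixhovenManin1991, Prop. 2] [cite: Mazur1978, Cor. 4.1]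
[cite: AbbesUllmo1996, Thm. A] [cite: Cesnavicius2018, Thm. 1.2] -/
theorem oddCutManinResidue_of_printedFacts
    (hMaz : mazur_not_dvd_maninConstant_of_odd) (hAU : abbesUllmo_not_dvd_maninConstant_of_not_dvd_level)
    (hCes : cesnavicius_not_two_dvd_maninConstant_of_two_dvd_level) (hnf : exists_isNewformOf) (hmodD : nonempty_modularParametrizationData) :
    ∀ (W : WeierstrassCurve ℚ) [W.IsElliptic] [W.IsGloballyMinimal] [NeZero (W.conductorNorm ℤ)],
      ¬ W.HasCM → W.analyticRank = 1 → Nat.card (W.selmerGroup 2) = 2 → Odd W.tamagawaProduct →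
      (∀ n : ℕ, 0 < n → W.HasSurjectiveModNGaloisRep ((2 : ℤ) ^ n)) →
      (∃ v : IsDedekindDomain.HeightOneSpectrum (𝓞 ℚ), ((2 : ℕ) : 𝓞 ℚ) ∉ v.asIdeal ∧ ((W.conductorNorm ℤ : ℕ) : 𝓞 ℚ) ∈ v.asIdeal ∧
        W.HasMultiplicativeReductionAt v) →
      4 ∣ W.conductorNorm ℤ → ∃ Dt : ModularParametrizationData W (W.conductorNorm ℤ), Odd Dt.c :=
  fun W _ _ _ _ _ _ _ hρ _ h4 ↦ exists_datum_odd_c_conductor_of_four_dvd hMaz hAU hCes hnf hmodD W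
    (hasIrreducibleModPGaloisRep_two_of_forall_hasSurjectiveModNGaloisRep W hρ) h4

/-! ## §3 In U₂'s own hypotheses -/

/-- **Odd Manin datum for a U₂-class curve with `4 ∣ N_W`, closed as typed**: `W/ℚ` globally minimal of analytic rank `1` with `#Sel₂(W) = 2`
(⟹ `E[2]` irreducible, via GZK for the rank) and `4 ∣ N_W` has a datum at level `N_W` with odd Manin constant, modulo the four binders of 22967,
`nonempty_modularParametrizationData` and GZK.  Inherits 22967's status (PROVED AS TYPED, UDC-dependent, (P†) pending); BSD is NOT proved.
[cite: CalegariDimitrovTang2025, Thm. 1.0.1] [cite: EdixhovenManin1991, Prop. 2] -/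
theorem exists_datum_odd_c_conductor_of_analyticRank_one_of_four_dvd
    (hMaz : mazur_not_dvd_maninConstant_of_odd) (hAU : abbesUllmo_not_dvd_maninConstant_of_not_dvd_level)
    (hCes : cesnavicius_not_two_dvd_maninConstant_of_two_dvd_level) (hnf : exists_isNewformOf) (hmodD : nonempty_modularParametrizationData)
    (hGZK : rank_eq_analyticRank_of_analyticRank_le_one)
    (W : WeierstrassCurve ℚ) [W.IsElliptic] [W.IsGloballyMinimal] [NeZero (W.conductorNorm ℤ)] (hr : W.analyticRank = 1)
    (hSel : Nat.card (W.selmerGroup 2) = 2) (h4 : 4 ∣ W.conductorNorm ℤ) :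
    ∃ Dt : ModularParametrizationData W (W.conductorNorm ℤ), Odd Dt.c :=
  exists_datum_odd_c_conductor_of_four_dvd hMaz hAU hCes hnf hmodD W
    (hasIrreducibleModPGaloisRep_two_of_analyticRank_one_of_natCard_selmerGroup_two hGZK W hr hSel) h4

/-- **Odd Manin datum at EVERY conductor for an `E[2]`-irreducible class, closed as typed** (the `4 ∤ N` half is g33's p816794 via Abbes–Ullmo /
Česnavičius; the `4 ∣ N` half is §1): `W/ℚ` globally minimal with `E[2]` irreducible has a datum at level `N_W` with odd Manin constant, modulo the
four binders of 22967 and `nonempty_modularParametrizationData`.  Inherits 22967's status on `4 ∣ N_W`; BSD is NOT proved.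
[cite: AbbesUllmo1996, Thm. A] [cite: Cesnavicius2018, Thm. 1.2] [cite: CalegariDimitrovTang2025, Thm. 1.0.1] [cite: EdixhovenManin1991, Prop. 2] -/
theorem exists_datum_odd_c_conductor_of_irreducible_two
    (hMaz : mazur_not_dvd_maninConstant_of_odd) (hAU : abbesUllmo_not_dvd_maninConstant_of_not_dvd_level)
    (hCes : cesnavicius_not_two_dvd_maninConstant_of_two_dvd_level) (hnf : exists_isNewformOf) (hmodD : nonempty_modularParametrizationData)
    (W : WeierstrassCurve ℚ) [W.IsElliptic] [W.IsGloballyMinimal] [NeZero (W.conductorNorm ℤ)] (hirr : W.HasIrreducibleModPGaloisRep 2) :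
    ∃ Dt : ModularParametrizationData W (W.conductorNorm ℤ), Odd Dt.c := by
  by_cases h4 : 4 ∣ W.conductorNorm ℤ
  · exact exists_datum_odd_c_conductor_of_four_dvd hMaz hAU hCes hnf hmodD W hirr h4
  · exact exists_datum_odd_c_conductor_of_irreducible_two_of_not_four_dvd hAU hCes hmodD W hirr h4

end Summit.BirchSwinnertonDyer.BirchSwinnertonDyer.Theorems.GenusExact.TwinSwap.OddManin

end
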